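import Summits.CriticalPhenomena.PercolationContinuityZ3.Theorems.Transplant.Z3NetLayered
import Summits.CriticalPhenomena.PercolationContinuityZ3.Theorems.Transplant.Z3TallGensSign
import Mathlib.Tactic.FinCases
import HarnessLib

/-!
# Periodic nets on `ℤ³`, VII — TOOLS: (a) the FINITE CHECK behind `SymmetricUnder` (centres and sites in the residue box suffice for a periodic
# net); (b) CAYLEY NETS `ofGens S` (constant step assignments; graph = the lane's `stepGraph 3 S`) and the TALL family re-derived as an instance
# of the generic device: `θ(p_c) = 0` on every tall `Cay(ℤ³; S)` whose `S` is carried to itself by a sign vector `(+, −, ε)`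

builds on p205010 (kernel theorem, internal audit signed; external expert review pending) — §2's continuity theorems run through `SignData.criticalContinuity`
(multi-type D″ node); §1 uses nothing of it.
Lane `prim-bschramm`, seat `prim-bschramm-p2` (gen 12; class C1b); helper file (`--supports stmt-CriticalPhenomena-4575 --as helper`).  Memo: `HOME/bschramm/P2-LATTICES.md` §36 (7).
(a) `SymmetricUnder ε` quantifies over every centre `t ∈ ℤ³` and every site `x ∈ ℤ³`; for a net with periods `n` both may be taken in the residue box `∏[0,nᵢ)`:
`refl ε (t + μ) x = refl ε t x + (μ − ε·μ)` and `refl ε t (x + μ) = refl ε t x + ε·μ` with `μ − ε·μ, ε·μ` in the (diagonal!) period lattice — so an instance is a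
finite check (`symmetricUnder_of_typesBox`).  (b) The constant assignment `x ↦ S` (`S = −S ∌ 0`) is a net whose graph is `stepGraph 3 S` on the nose (`ofGens_graph`);
it is periodic with periods `(1,1,1)` and `SymmetricUnder ε ↔ ε·S ⊆ S`.  For p2-g11's `TallGens` (`{±eᵢ} ⊆ S ⊆ {−1,0,1}² × ℤ`): flat, linked (by `e₂`), `(−,−,−)` is
`S = −S`, so ONE sign vector `(+,−,ε)` preserving `S` gives `SignData` and `θ(v, p_c) = 0` — the same theorem as g11's `criticalContinuity_of_flipY` (`ε = 1`) /
`_of_flipYZ` (`ε = −1`), now as a corollary of the generic device (regression `tall_criticalContinuity_of_flipY`).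
* §1 `refl_add_centre`, `sgn_mem_periodLattice`, `sub_sgn_mem_periodLattice`, **`symmetricUnder_of_typesBox`**;
* §2 `ofGens`, `ofGens_graph`, `ofGens_periodic`, `ofGens_symmetricUnder_iff`; `TallGens.toZ3Net`, `toZ3Net_graph`, `signDataOfSgn`,
  **`TallGens.criticalContinuity_of_sgn`**, `tall_criticalContinuity_of_flipY`, `tall_criticalContinuity_of_flipYZ`.
[cite: KozmaNitzan2024, §4 p. 16 (Lemma 8)] [cite: BenjaminiSchramm1996, §2 (Cayley graphs), Conj. 4] [cite: GrimmettPercolation1999, §12.1 p. 349]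
-/

noncomputable section

namespace Summit.CriticalPhenomena.PercolationContinuityZ3.Theorems.Transplant

open MeasureTheory Literature.Probability.Percolation Literature.Probability.LatticeModels SimpleGraph
open Z3Diag (ev proj)
open scoped Classical

namespace Z3Net

/-! ## §1 The finite check behind `SymmetricUnder` -/

/-- Moving the centre by `μ` translates the centred sign change by `μ − ε·μ`. [folklore] -/
theorem refl_add_centre (ε : Fin 3 → ℤˣ) (t μ x : Site 3) : refl ε (t + μ) x = refl ε t x + (μ - sgn ε μ) := by
  ext i
  simp only [refl_apply, Pi.add_apply, Pi.sub_apply, sgn_apply]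
  ring

/-- A sign change of a period-lattice vector is a period-lattice vector (the lattice is diagonal). [folklore] -/
theorem sgn_mem_periodLattice {n : Fin 3 → ℕ} {μ : Site 3} (hμ : μ ∈ periodLattice n) (ε : Fin 3 → ℤˣ) : sgn ε μ ∈ periodLattice n :=
  fun i => by rw [sgn_apply]; exact Dvd.dvd.mul_left (hμ i) _

/-- `μ − ε·μ` is a period-lattice vector for `μ` in the period lattice (coordinates `0` or `2μᵢ`). [folklore] -/
theorem sub_sgn_mem_periodLattice {n : Fin 3 → ℕ} {μ : Site 3} (hμ : μ ∈ periodLattice n) (ε : Fin 3 → ℤˣ) :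
    μ - sgn ε μ ∈ periodLattice n :=
  fun i => by rw [Pi.sub_apply]; exact (hμ i).sub (sgn_mem_periodLattice hμ ε i)

variable (N : Z3Net)

/-- **THE FINITE CHECK**: a periodic net is `SymmetricUnder ε` as soon as every step at every site OF THE RESIDUE BOX is carried along by the sign
change centred at every point OF THE RESIDUE BOX. [cite: KozmaNitzan2024, §4 p. 16 (Lemma 8)] -/
theorem symmetricUnder_of_typesBox {n : Fin 3 → ℕ} (h : N.Periodic n) (hn : ∀ i, 0 < n i) {ε : Fin 3 → ℤˣ}
    (hε : ∀ t ∈ typesBox n, ∀ x ∈ typesBox n, ∀ s ∈ N.stepsAt x, sgn ε s ∈ N.stepsAt (refl ε t x)) : N.SymmetricUnder ε := by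
  intro t x s hs
  have e1 : refl ε t x = refl ε (residue n t) x + ((t - residue n t) - sgn ε (t - residue n t)) := by
    conv_lhs => rw [show t = residue n t + (t - residue n t) by abel]
    exact refl_add_centre ε _ _ x
  have e2 : refl ε (residue n t) x = refl ε (residue n t) (residue n x) + sgn ε (x - residue n x) := by
    conv_lhs => rw [show x = residue n x + (x - residue n x) by abel]
    rw [refl_add]
  rw [e1, N.stepsAt_add_of_mem_periodLattice h (sub_sgn_mem_periodLattice (sub_residue_mem_periodLattice n t) ε), e2,
    N.stepsAt_add_of_mem_periodLattice h (sgn_mem_periodLattice (sub_residue_mem_periodLattice n x) ε)]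
  have hs' : s ∈ N.stepsAt (residue n x) := by rwa [N.stepsAt_residue h]
  exact hε _ (residue_mem_typesBox hn t) _ (residue_mem_typesBox hn x) s hs'

/-! ## §2 Cayley nets and the tall family as an instance -/

/-- **The Cayley net of a symmetric generating set** `S = −S ∌ 0`: the constant step assignment. [cite: BenjaminiSchramm1996, §2 (Cayley graphs)] -/
def ofGens (S : Finset (Site 3)) (h0 : (0 : Site 3) ∉ S) (hS : ∀ s ∈ S, -s ∈ S) : Z3Net where
  stepsAt := fun _ => S
  zero_notMem := fun _ => h0
  symm := fun _ s hs => hS s hs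

/-- The steps of a Cayley net. [folklore] -/
@[simp] theorem ofGens_stepsAt (S : Finset (Site 3)) (h0 hS) (x : Site 3) : (ofGens S h0 hS).stepsAt x = S := rfl

/-- **The graph of the Cayley net IS the lane's `stepGraph 3 S`.** [folklore] -/
theorem ofGens_graph (S : Finset (Site 3)) (h0 : (0 : Site 3) ∉ S) (hS : ∀ s ∈ S, -s ∈ S) : (ofGens S h0 hS).graph = stepGraph 3 S := by
  ext x y
  rw [graph_adj_iff, ofGens_stepsAt, stepGraph_adj_iff]
  constructor
  · intro h
    exact ⟨fun hxy => h0 (by rwa [hxy, sub_self] at h), Or.inl h⟩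
  · rintro ⟨-, h | h⟩
    · exact h
    · have := hS _ h; rwa [neg_sub] at this

/-- A Cayley net has every period. [folklore] -/
theorem ofGens_periodic (S : Finset (Site 3)) (h0 hS) (n : Fin 3 → ℕ) : (ofGens S h0 hS).Periodic n := fun _ _ => rfl

/-- For a Cayley net, `SymmetricUnder ε` is `ε·S ⊆ S`. [folklore] -/
theorem ofGens_symmetricUnder_iff (S : Finset (Site 3)) (h0 hS) (ε : Fin 3 → ℤˣ) :
    (ofGens S h0 hS).SymmetricUnder ε ↔ ∀ s ∈ S, sgn ε s ∈ S :=
  ⟨fun h s hs => h 0 0 s hs, fun h _ _ s hs => h s hs⟩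

/-- The sign vector `(−,−,−)` is negation. [folklore] -/
theorem sgn_neg_one (s : Site 3) : sgn ![-1, -1, -1] s = -s := by
  ext i; fin_cases i <;> simp [sgn]

end Z3Net

namespace TallGens

open Z3Net

variable (T : TallGens)

/-- **The tall Cayley graph as a net.** [folklore] -/
def toZ3Net : Z3Net := Z3Net.ofGens T.S T.zero_notMem T.symm

/-- Its graph is `T.graph = stepGraph 3 S`. [folklore] -/
theorem toZ3Net_graph : T.toZ3Net.graph = T.graph := Z3Net.ofGens_graph T.S T.zero_notMem T.symm

/-- The tall net is flat (`±e₀, ±e₁ ∈ S`). [folklore] -/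
theorem toZ3Net_flat : T.toZ3Net.Flat := fun _ => ⟨T.axes 0, T.neg_axes 0, T.axes 1, T.neg_axes 1⟩

/-- The tall net is linked (`e₂ ∈ S`). [folklore] -/
theorem toZ3Net_linked : T.toZ3Net.Linked := fun x =>
  ⟨x, x + ev 2, T.toZ3Net.adj_add_of_mem (T.axes 2), rfl, by simp [ev], by simp, by simp, by simp [ev], by simp [ev]⟩

/-- **Sign data of the tall net from ONE sign vector `(+,−,ε)` preserving `S`** (the central inversion `(−,−,−)` is `S = −S`).
[cite: KozmaNitzan2024, §4 p. 16 (Lemma 8)] -/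
def signDataOfSgn (ε : ℤˣ) (hε : ∀ s ∈ T.S, Z3Net.sgn ![1, -1, ε] s ∈ T.S) : T.toZ3Net.SignData :=
  Z3Net.SignData.ofFlat T.toZ3Net_flat T.toZ3Net_linked ![1, 1, 1] (fun i => by fin_cases i <;> simp)
    (Z3Net.ofGens_periodic _ _ _ _) (fun _ s hs => T.planar s hs) T.vrange (fun _ _ hs => T.abs_apply_two_le hs)
    (-1) ((Z3Net.ofGens_symmetricUnder_iff _ _ _ _).2 fun s hs => by rw [Z3Net.sgn_neg_one]; exact T.symm s hs)
    ε ((Z3Net.ofGens_symmetricUnder_iff _ _ _ _).2 hε)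

/-- **`θ(v, p_c) = 0` on every tall `Cay(ℤ³; S)` with `(+,−,ε)·S ⊆ S`** — through the generic device (files II–III). builds on p205010 (kernel
theorem, internal audit signed; external expert review pending). [cite: BenjaminiSchramm1996, Conj. 4] -/
theorem criticalContinuity_of_sgn (ε : ℤˣ) (hε : ∀ s ∈ T.S, Z3Net.sgn ![1, -1, ε] s ∈ T.S) (v : Site 3) :
    theta T.graph v (criticalProbIOf T.graph v) = 0 := by
  have h := (T.signDataOfSgn ε hε).criticalContinuity v
  rwa [toZ3Net_graph] at h

/-- **Regression: g11's `criticalContinuity_of_flipY` re-derived** (`flipY = (+,−,+)`). builds on p205010 (kernel theorem, internal audit signed;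
external expert review pending). [cite: BenjaminiSchramm1996, Conj. 4] -/
theorem tall_criticalContinuity_of_flipY (hS : ∀ s ∈ T.S, Z3Diag.flipY s ∈ T.S) (v : Site 3) :
    theta T.graph v (criticalProbIOf T.graph v) = 0 :=
  T.criticalContinuity_of_sgn 1 (fun s hs => by
    have e : Z3Net.sgn ![1, -1, 1] s = Z3Diag.flipY s := by ext i; fin_cases i <;> simp [Z3Net.sgn, Z3Diag.flipY]
    rw [e]; exact hS s hs) v

/-- **Regression: g11's `criticalContinuity_of_flipYZ` re-derived** (`flipYZ = (+,−,−)`, the half-turn about `e₀`). builds on p205010 (kernel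
theorem, internal audit signed; external expert review pending). [cite: BenjaminiSchramm1996, Conj. 4] -/
theorem tall_criticalContinuity_of_flipYZ (hS : ∀ s ∈ T.S, UnitGens.flipYZ s ∈ T.S) (v : Site 3) :
    theta T.graph v (criticalProbIOf T.graph v) = 0 :=
  T.criticalContinuity_of_sgn (-1) (fun s hs => by
    have e : Z3Net.sgn ![1, -1, -1] s = UnitGens.flipYZ s := by ext i; fin_cases i <;> simp [Z3Net.sgn, UnitGens.flipYZ]
    rw [e]; exact hS s hs) v

end TallGens

end Summit.CriticalPhenomena.PercolationContinuityZ3.Theorems.Transplant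

end
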